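import Literature.AlgebraicGeometry.Resolution.HenselsLemmaProofs
import Literature.AlgebraicGeometry.Resolution.CompositeValuations
import Literature.AlgebraicGeometry.Resolution.ValuationOverrings
import Mathlib.Algebra.Polynomial.Identities
import HarnessLib

/-!
# Hensel roots inside an ambient valued field: existence in henselian subfields, uniqueness, coarsenings

Topic: `Literature/AlgebraicGeometry/Resolution` (valued function fields). Glue for the proof of
F.-V. Kuhlmann, *Elimination of ramification II: Henselian rationality*, Israel J. Math. 234
(2019) = arXiv:1701.05508, **Prop. 5.6** (`Kuhlmann2019HenselianRationalityFiniteRankProofs.lean`).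
There the henselization `F^{h(P)}` of an immediate function field is compared with
`K(x)^{h(P)}` through TWO valuations at once — the place `P` and its coarsening `P₁` — and our
assembly does this with one monic polynomial `h` over `O_{K(x)}` (a lift of the minimal
polynomial of a henselian element of `FP₁ | KP₁(xP₁)`, Kuhlmann–Novacoski 2014, Thm. 1.2):
Hensel's Lemma for `P₁` in `F.K(x)^{h(P₁)}` and for `P` in `K(x)^{h(P)}` produce roots of `h`
which coincide by the UNIQUENESS half of Hensel's Lemma for `P` in the ambient field. This
file provides these elementary tools in the ambient rendering of `Henselization.lean` (one
valued field `(Ω, U)`, subfields `E ≤ Ω` valued by `U ∩ E`, polynomials over `Ω` with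
coefficients in `U ∩ E`):

* `exists_root_of_isHenselianField` — **Hensel's Lemma in a henselian subfield**: for
  `(E, U ∩ E)` henselian (`IsHenselianField`, hence `U ∩ E` a henselian local ring by
  `Kuhlmann2010HenselsLemma_holds`), a monic `p` with coefficients in `U ∩ E` and an
  approximate root `a ∈ U ∩ E` (`v(p(a)) < 1`, `v(p'(a)) = 1`) has a root `α ∈ U ∩ E` with
  `v(α - a) < 1`.
* `eq_of_roots_of_valuation_sub_lt_one` — **uniqueness**: two roots `α, β ∈ U` of a polynomial
  with coefficients in `U`, with `v(α - β) < 1` and `v(p'(α)) = 1`, are equal (Taylor expansion: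
  `0 = (β - α)·(p'(α) + (β - α)·k)` with a unit second factor).
* congruences: `valuation_eval_sub_lt_one` (`a ≡ b ⇒ p(a) ≡ p(b)` modulo the maximal ideal),
  `valuation_eq_one_of_sub` (a unit plus a small element is a unit), `isUnit_comap_subfield_iff`
  (units of `U ∩ E` are the elements of `U`-value `1`).
* coarsenings `V ≤ W` and the residue valuation ring `V/𝔪_W` of the residue field of `W`
  (`residueValuationSubring`, `CompositeValuations.lean`): `mem_and_valuation_lt_one_of_le`
  (`𝔪_W ⊆ 𝔪_V`), `valuation_residue_eq_one_iff` (the `W`-residue of `y` is a unit of `V/𝔪_W`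
  iff `y` is a unit of `V`), `valuation_residue_lt_one_iff`.

Everything here is standard valuation theory (Engler–Prestel, *Valued Fields*, §§2.3, 4.1;
Kuhlmann 2010, §1.1: "henselian … if and only if `(K,v)` satisfies Hensel's Lemma") and PROVED.

## Sources

* F.-V. Kuhlmann, Trans. AMS 362 (2010) = arXiv:1003.5678, §1.1 (Hensel's Lemma).
* F.-V. Kuhlmann, Israel J. Math. 234 (2019) = arXiv:1701.05508, proof of Prop. 5.6 (p. 13).
-/

noncomputable section

open IsLocalRing Polynomial

namespace Literature.AlgebraicGeometry.Resolution

universe u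

variable {Ω : Type u} [Field Ω]

/-! ### Units and small elements -/

section Units

variable (U : ValuationSubring Ω)

/-- A unit plus an element of smaller value is a unit: `v(x) = 1`, `v(y - x) < 1 ⇒ v(y) = 1`.
[folklore] -/
theorem valuation_eq_one_of_sub {x y : Ω} (hx : U.valuation x = 1)
    (h : U.valuation (y - x) < 1) : U.valuation y = 1 := by
  have h' : U.valuation (y - x) < U.valuation x := by rw [hx]; exact h
  have : y = y - x + x := (sub_add_cancel y x).symm
  rw [this, U.valuation.map_add_eq_of_lt_right h', hx]

/-- **Units of `U ∩ E`** are the elements of `U`-value `1`. [folklore] -/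
theorem isUnit_comap_subfield_iff (E : Subfield Ω) (z : U.comap (algebraMap E Ω)) :
    IsUnit z ↔ U.valuation ((z : E) : Ω) = 1 := by
  rw [← isUnit_map_iff (comapSubringHom E U) z, U.valuation_eq_one_iff]
  rfl

/-- **The maximal ideal of `U ∩ E`** consists of the elements of `U`-value `< 1`. [folklore] -/
theorem mem_maximalIdeal_comap_iff_valuation_lt_one (E : Subfield Ω) (z : U.comap (algebraMap E Ω)) :
    z ∈ maximalIdeal (U.comap (algebraMap E Ω)) ↔ U.valuation ((z : E) : Ω) < 1 := by
  rw [IsLocalRing.mem_maximalIdeal, mem_nonunits_iff, isUnit_comap_subfield_iff]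
  constructor
  · intro h
    exact lt_of_le_of_ne ((U.valuation_le_one_iff _).mpr z.2) h
  · intro h
    exact h.ne

end Units

/-! ### Polynomials with coefficients in `U`: congruences and the uniqueness of Hensel roots -/

section Congruence

variable (U : ValuationSubring Ω)

/-- A polynomial over `Ω` with coefficients in `U` comes from a polynomial over `U`. [folklore] -/
theorem exists_map_subtype_eq {p : Polynomial Ω} (hcoef : ∀ k, p.coeff k ∈ U) :
    ∃ q : Polynomial U, q.map U.subtype = p := by
  have : p ∈ Polynomial.lifts U.subtype := by
    rw [Polynomial.lifts_iff_coeff_lifts]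
    intro k
    exact ⟨⟨p.coeff k, hcoef k⟩, rfl⟩
  exact (Polynomial.mem_lifts p).mp this

/-- `p(a) ∈ U` for `a ∈ U` and `p` with coefficients in `U`. [folklore] -/
theorem valuationSubring_eval_mem_of_coeff_mem {p : Polynomial Ω} (hcoef : ∀ k, p.coeff k ∈ U) {a : Ω}
    (ha : a ∈ U) : p.eval a ∈ U := by
  obtain ⟨q, rfl⟩ := exists_map_subtype_eq U hcoef
  rw [Polynomial.eval_map, show a = U.subtype ⟨a, ha⟩ from rfl, Polynomial.eval₂_hom]
  exact SetLike.coe_mem _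

/-- **`a ≡ b` modulo `𝔪_U` implies `p(a) ≡ p(b)`** for `p` with coefficients in `U`
(`a - b ∣ p(a) - p(b)` in `U`). [folklore] -/
theorem valuation_eval_sub_lt_one {p : Polynomial Ω} (hcoef : ∀ k, p.coeff k ∈ U) {a b : Ω}
    (ha : a ∈ U) (hb : b ∈ U) (hab : U.valuation (a - b) < 1) :
    U.valuation (p.eval a - p.eval b) < 1 := by
  obtain ⟨q, rfl⟩ := exists_map_subtype_eq U hcoef
  obtain ⟨c, hc⟩ := Polynomial.sub_dvd_eval_sub (⟨a, ha⟩ : U) ⟨b, hb⟩ q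
  have h1 : (q.map U.subtype).eval a - (q.map U.subtype).eval b =
      (a - b) * (c : Ω) := by
    have := congrArg (U.subtype : U → Ω) hc
    simp only [map_sub, map_mul] at this
    rw [Polynomial.eval_map, Polynomial.eval_map,
      show a = U.subtype ⟨a, ha⟩ from rfl, show b = U.subtype ⟨b, hb⟩ from rfl,
      Polynomial.eval₂_hom, Polynomial.eval₂_hom]
    exact this
  rw [h1, map_mul]
  calc U.valuation (a - b) * U.valuation (c : Ω) ≤ U.valuation (a - b) * 1 :=
        mul_le_mul' le_rfl (U.valuation_le_one c)
    _ < 1 := by rw [mul_one]; exact hab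

/-- **Uniqueness of Hensel roots**: if `α, β ∈ U` are roots of a polynomial `p` with
coefficients in `U`, `v(β - α) < 1` and `v(p'(α)) = 1`, then `α = β` (the Taylor expansion
`0 = p(β) = p(α) + p'(α)(β - α) + k(β - α)²` exhibits `β - α` times a unit of `U`).
[folklore] -/
theorem eq_of_roots_of_valuation_sub_lt_one {p : Polynomial Ω} (hcoef : ∀ k, p.coeff k ∈ U)
    {α β : Ω} (hα : α ∈ U) (hβ : β ∈ U) (hpα : p.eval α = 0) (hpβ : p.eval β = 0)
    (hαβ : U.valuation (β - α) < 1) (hder : U.valuation ((derivative p).eval α) = 1) :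
    α = β := by
  obtain ⟨q, rfl⟩ := exists_map_subtype_eq U hcoef
  set a : U := ⟨α, hα⟩ with ha
  set b : U := ⟨β, hβ⟩ with hb
  have hevala : q.eval a = 0 := by
    apply U.subtype_injective
    rw [map_zero, ← hpα, Polynomial.eval_map, show α = U.subtype a from rfl, Polynomial.eval₂_hom]
  have hevalb : q.eval b = 0 := by
    apply U.subtype_injective
    rw [map_zero, ← hpβ, Polynomial.eval_map, show β = U.subtype b from rfl, Polynomial.eval₂_hom]
  have hder' : U.valuation (((derivative q).eval a : U) : Ω) = 1 := by
    rw [← hder, Polynomial.derivative_map, Polynomial.eval_map, show α = U.subtype a from rfl,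
      Polynomial.eval₂_hom]
    rfl
  obtain ⟨k, hk⟩ := Polynomial.binomExpansion q a (b - a)
  rw [add_sub_cancel, hevalb, hevala, zero_add] at hk
  -- `0 = (b - a) * (q'(a) + k (b - a))`, the second factor a unit
  have hfact : (b - a) * ((derivative q).eval a + k * (b - a)) = 0 := by
    rw [mul_add, mul_comm (b - a) (k * (b - a)), mul_assoc, ← sq, mul_comm (b - a)]
    exact hk.symm
  have hunit : U.valuation (((derivative q).eval a + k * (b - a) : U) : Ω) = 1 := by
    push_cast
    refine valuation_eq_one_of_sub U hder' ?_
    rw [add_sub_cancel_left, map_mul]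
    calc U.valuation (k : Ω) * U.valuation ((b : Ω) - a) ≤ 1 * U.valuation ((b : Ω) - a) :=
          mul_le_mul' (U.valuation_le_one k) le_rfl
      _ < 1 := by rw [one_mul]; exact hαβ
  have hne : ((derivative q).eval a + k * (b - a) : U) ≠ 0 := by
    intro h0
    rw [h0, ZeroMemClass.coe_zero, map_zero] at hunit
    exact zero_ne_one hunit
  have hba : b - a = 0 := (mul_eq_zero.mp hfact).resolve_right hne
  have := congrArg (U.subtype : U → Ω) hba
  rw [map_sub, map_zero, sub_eq_zero] at this
  exact this.symm

end Congruence

/-! ### Hensel's Lemma in a henselian subfield of `Ω` -/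

section Existence

variable (U : ValuationSubring Ω)

/-- **Hensel's Lemma in a henselian subfield.** Let `E ≤ Ω` with `(E, U ∩ E)` henselian
(`IsHenselianField`; then `U ∩ E` is a henselian local ring, `Kuhlmann2010HenselsLemma_holds`,
Kuhlmann 2010 §1.1), `p` a monic polynomial over `Ω` with coefficients in `U ∩ E`, and
`a ∈ U ∩ E` an approximate root: `v(p(a)) < 1` and `v(p'(a)) = 1`. Then `p` has a root
`α ∈ U ∩ E` with `v(α - a) < 1`. PROVED. [cite: Kuhlmann2010, Section 1.1] -/
theorem exists_root_of_isHenselianField {E : Subfield Ω}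
    (hE : IsHenselianField E (U.comap (algebraMap E Ω))) {p : Polynomial Ω} (hmon : p.Monic)
    (hcoef : ∀ k, p.coeff k ∈ U ∧ p.coeff k ∈ E) {a : Ω} (haE : a ∈ E) (haU : a ∈ U)
    (ha : U.valuation (p.eval a) < 1) (ha' : U.valuation ((derivative p).eval a) = 1) :
    ∃ α ∈ E, α ∈ U ∧ p.eval α = 0 ∧ U.valuation (α - a) < 1 := by
  set O : ValuationSubring E := U.comap (algebraMap E Ω) with hO
  haveI : HenselianLocalRing O := Kuhlmann2010HenselsLemma_holds E O hE
  -- the composite inclusion `O → E → Ω`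
  let φ : O →+* Ω := (algebraMap E Ω).comp (algebraMap O E)
  have hφ : ∀ z : O, φ z = ((z : E) : Ω) := fun _ => rfl
  -- lift `p` to a monic polynomial over `O`
  have hlifts : p ∈ Polynomial.lifts φ := by
    rw [Polynomial.lifts_iff_coeff_lifts]
    intro k
    exact ⟨⟨⟨p.coeff k, (hcoef k).2⟩, (hcoef k).1⟩, rfl⟩
  obtain ⟨q, hq, -, hqmon⟩ := Polynomial.lifts_and_degree_eq_and_monic hlifts hmon
  set a₀ : O := ⟨⟨a, haE⟩, haU⟩ with ha₀
  have hφa : φ a₀ = a := rfl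
  have heval : ∀ (r : Polynomial O) (w : O), φ (r.eval w) = (r.map φ).eval (φ w) := fun r w => by
    rw [Polynomial.eval_map, Polynomial.eval₂_hom]
  -- the hypotheses of Hensel's Lemma in `O`
  have h1 : q.eval a₀ ∈ maximalIdeal O := by
    rw [mem_maximalIdeal_comap_iff_valuation_lt_one, ← hφ, heval, hq, hφa]
    exact ha
  have h2 : IsUnit ((derivative q).eval a₀) := by
    rw [isUnit_comap_subfield_iff, ← hφ, heval, ← Polynomial.derivative_map, hq, hφa]
    exact ha'
  obtain ⟨z, hz, hza⟩ := HenselianLocalRing.is_henselian q hqmon a₀ h1 h2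
  refine ⟨((z : E) : Ω), (z : E).2, z.2, ?_, ?_⟩
  · have := congrArg φ hz.eq_zero
    rw [heval, hq, map_zero, hφ] at this
    exact this
  · have := (mem_maximalIdeal_comap_iff_valuation_lt_one U E _).mp hza
    simpa using this

end Existence

/-! ### Coarsenings `V ≤ W` and the residue valuation ring `V/𝔪_W` -/

section Coarsening

variable {V W : ValuationSubring Ω} (hVW : V ≤ W)

include hVW

/-- **`𝔪_W ⊆ 𝔪_V ⊆ V`**: an element of `W`-value `< 1` lies in `V` and has `V`-value `< 1`.
[folklore] -/
theorem mem_and_valuation_lt_one_of_le {z : Ω} (hz : W.valuation z < 1) :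
    z ∈ V ∧ V.valuation z < 1 := by
  have hzV : V.valuation z < 1 := valuation_lt_one_of_le_of_lt_one hVW hz
  exact ⟨(V.valuation_le_one_iff z).mp hzV.le, hzV⟩

/-- **Units of `V/𝔪_W` come from units of `V`**: for `y ∈ W`, the `W`-residue of `y` has
value `1` for the residue valuation ring `V/𝔪_W` iff `v_V(y) = 1`. [folklore] -/
theorem valuation_residue_eq_one_iff (y : W) :
    (residueValuationSubring V W hVW).valuation (residue W y) = 1 ↔ V.valuation (y : Ω) = 1 := by
  constructor
  · intro h
    have hr0 : residue W y ≠ 0 := fun h0 => by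
      rw [h0, map_zero] at h
      exact zero_ne_one h
    have hy0 : (y : Ω) ≠ 0 := fun h0 => hr0 (by
      have : y = 0 := Subtype.ext h0
      rw [this, map_zero])
    obtain ⟨hmem, hinv⟩ :=
      (valuation_eq_one_iff_mem_and_inv_mem (residueValuationSubring V W hVW) hr0).mp h
    have hyV : (y : Ω) ∈ V := (residue_mem_residueValuationSubring_iff V W hVW y).mp hmem
    -- `y` is a unit of `W`, so `y⁻¹ ∈ W` and its residue is the inverse residue
    have hyunit : IsUnit y := by
      by_contra hnu
      exact hr0 ((residue_eq_zero_iff y).mpr ((IsLocalRing.mem_maximalIdeal y).mpr hnu))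
    have hyiW : (y : Ω)⁻¹ ∈ W := inv_mem_of_isUnit W y.2 (by simpa using hyunit)
    have hres : residue W ⟨(y : Ω)⁻¹, hyiW⟩ = (residue W y)⁻¹ := by
      have := residue_mk_inv W y.2 hyiW hy0
      simpa using this
    have hyiV : (y : Ω)⁻¹ ∈ V := by
      rw [← residue_mem_residueValuationSubring_iff V W hVW ⟨(y : Ω)⁻¹, hyiW⟩, hres]
      exact hinv
    exact (valuation_eq_one_iff_mem_and_inv_mem V hy0).mpr ⟨hyV, hyiV⟩
  · intro h
    have hy0 : (y : Ω) ≠ 0 := fun h0 => by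
      rw [h0, map_zero] at h
      exact zero_ne_one h
    obtain ⟨hyV, hyiV⟩ := (valuation_eq_one_iff_mem_and_inv_mem V hy0).mp h
    have hyiW : (y : Ω)⁻¹ ∈ W := hVW hyiV
    have hr0 : residue W y ≠ 0 := by
      intro h0
      rw [residue_eq_zero_iff, ValuationSubring.valuation_lt_one_iff] at h0
      have := valuation_lt_one_of_le_of_lt_one hVW h0
      rw [h] at this
      exact lt_irrefl _ this
    refine (valuation_eq_one_iff_mem_and_inv_mem (residueValuationSubring V W hVW) hr0).mpr
      ⟨(residue_mem_residueValuationSubring_iff V W hVW y).mpr hyV, ?_⟩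
    have hres : residue W ⟨(y : Ω)⁻¹, hyiW⟩ = (residue W y)⁻¹ := by
      have := residue_mk_inv W y.2 hyiW hy0
      simpa using this
    rw [← hres]
    exact (residue_mem_residueValuationSubring_iff V W hVW _).mpr hyiV

/-- **Small elements of `V/𝔪_W` come from small elements of `V`**: for `y ∈ W`, the
`W`-residue of `y` has value `< 1` for `V/𝔪_W` iff `v_V(y) < 1`. [folklore] -/
theorem valuation_residue_lt_one_iff (y : W) :
    (residueValuationSubring V W hVW).valuation (residue W y) < 1 ↔ V.valuation (y : Ω) < 1 := by
  constructor
  · intro h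
    have hmem : residue W y ∈ residueValuationSubring V W hVW :=
      ((residueValuationSubring V W hVW).valuation_le_one_iff _).mp h.le
    have hyV : (y : Ω) ∈ V := (residue_mem_residueValuationSubring_iff V W hVW y).mp hmem
    refine lt_of_le_of_ne ((V.valuation_le_one_iff _).mpr hyV) fun h1 => ?_
    rw [(valuation_residue_eq_one_iff hVW y).mpr h1] at h
    exact lt_irrefl _ h
  · intro h
    have hyV : (y : Ω) ∈ V := (V.valuation_le_one_iff _).mp h.le
    have hmem : residue W y ∈ residueValuationSubring V W hVW :=
      (residue_mem_residueValuationSubring_iff V W hVW y).mpr hyV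
    refine lt_of_le_of_ne (((residueValuationSubring V W hVW).valuation_le_one_iff _).mpr hmem)
      fun h1 => ?_
    rw [(valuation_residue_eq_one_iff hVW y).mp h1] at h
    exact lt_irrefl _ h

end Coarsening

end Literature.AlgebraicGeometry.Resolution
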